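import Mathlib
import Summits.ResolutionOfSingularities.ResolutionOfSingularities.Theorems.RadicialJungCleanModelsCleanTauTwoSlice
import Summits.ResolutionOfSingularities.ResolutionOfSingularities.Theorems.FrobeniusLadderFInjectiveMacaulayficationProp44PointStepRT
import Summits.ResolutionOfSingularities.ResolutionOfSingularities.Theorems.FrobeniusLadderFInjectiveMacaulayficationProp44Invariants
import HarnessLib

/-!
# Route `RadicialJung`, crux `CleanModels` (stmt-ResolutionOfSingularities-15917), line `Sketch` rev 35, stub 6 `stub_cleanProp44` (X44c):
# CLEAN REACH-TIDY, PHASE I — point blow-ups at bad points reach a stage whose `Σ`-curves are regular and pairwise transverse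

The hypothesis `hreach` of the clean assemblies ✓ `cleanProp44_of_cleanPieces` / `cleanProp44_of_tauOnePieces` splits as in the tree's
✓ `CP2008Prop44.reach_tidy` into Phase I ([CoP1] steps 1–2: blow up BAD POINTS — singular points of curves of `Σ`, non-transverse crossings — until
none is left; ✓ `CP2008Prop44.exists_seq_regular_transverse`) and Phase II (step 3: blow up intersecting CURVES).  Phase I has point centres only, so
its clean twin is mechanical:

* `exists_cleanChain_of_forall_step` — dependent choice along `IsCleanPermissibleSeq` (clean twin of ✓ `CP2008Prop44.exists_chain_of_forall_step`).
* `exists_cleanSeq_regular_transverse` — **CLEAN PHASE I**: from an integral Noetherian regular quasi-excellent `X` of dimension `≤ 3` with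
  `char K(X) = p`, the line of `G` clean-regular everywhere, `(J, μ)` (`μ ≥ 1`, `ord ≤ μ`, `codim V(J) ≥ 2`), a CLEAN-permissible sequence of point
  blowing-ups reaches a stage with NO bad point (the curves of `Σ = {ord ≥ μ}` are regular and pairwise transverse).  Proof verbatim from the tree
  (termination ✓ `false_of_badPointChain_of_curveConfiguration`, successor rule ✓ `pointStep_next`), each point step clean by
  ✓ `IsCleanPermissibleSeq.cons_point`.

So `hreach` reduces to CLEAN PHASE II (blow up intersecting `Σ`-curves of a regular transverse configuration, keeping cleanness — where L7b
insertions may be needed at crossings, [CoP1] step 3 / memo 4e §4 (b)).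

Honest framing: OURS; nothing here proves X44c, any case of `CleanModels`, or resolution of singularities in characteristic `p`.
-/

noncomputable section

set_option linter.dupNamespace false -- mandated namespace of this single-conjunct summit

open CategoryTheory CategoryTheory.Limits AlgebraicGeometry TopologicalSpace IsLocalRing
open Literature.AlgebraicGeometry.Resolution Literature.AlgebraicGeometry.Motives
open Scheme.IdealSheafData
open Summit.ResolutionOfSingularities.ResolutionOfSingularities.Theorems.CP2008Prop44

namespace Summit.ResolutionOfSingularities.ResolutionOfSingularities.Theorems.RadicialJung.CleanModels

/-! ## §1 Infinite runs by dependent choice, clean version -/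

/-- **Dependent choice along `IsCleanPermissibleSeq`.**  If every stage reachable from `(X, J, μ, G)` by a clean-permissible sequence admits one more
blowing up (integral top, dominant) extending the clean-permissible sequence, with a property `P` of the centre, then there is an infinite run of such
blowing-ups, every step of which has `P`.  Clean twin of ✓ `CP2008Prop44.exists_chain_of_forall_step`. [folklore] -/
theorem exists_cleanChain_of_forall_step {p : ℕ} {X : Scheme.{0}} [IsIntegral X] (J : X.IdealSheafData) {μ : ℕ} (G : X.functionField)
    (P : ∀ (X₁ : Scheme.{0}), X₁.IdealSheafData → Closeds X₁ → Prop)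
    (H : ∀ (X₁ : Scheme.{0}) [IsIntegral X₁] (Φ : X₁ ⟶ X) [IsDominant Φ] (J₁ : X₁.IdealSheafData), IsCleanPermissibleSeq p Φ J μ J₁ G →
      ∃ (X₂ : Scheme.{0}) (_ : IsIntegral X₂) (π : X₂ ⟶ X₁) (_ : IsDominant π) (D : Closeds X₁),
        IsBlowup π (vanishingIdeal D) ∧ IsCleanPermissibleSeq p (π ≫ Φ) J μ (controlledTransform π (vanishingIdeal D) J₁ μ) G ∧ P X₁ J₁ D) :
    ∃ (Xs : ℕ → Scheme.{0}) (_ : ∀ n, IsIntegral (Xs n)) (π : ∀ n, Xs (n + 1) ⟶ Xs n) (D : ∀ n, Closeds (Xs n))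
      (Js : ∀ n, (Xs n).IdealSheafData) (Φ : ∀ n, Xs n ⟶ X) (_ : ∀ n, IsDominant (Φ n)),
      (∀ n, IsBlowup (π n) (vanishingIdeal (D n))) ∧
      (∀ n, IsCleanPermissibleSeq p (Φ n) J μ (Js n) G) ∧
      (∀ n, Js (n + 1) = controlledTransform (π n) (vanishingIdeal (D n)) (Js n) μ) ∧
      (∀ n, P (Xs n) (Js n) (D n)) := by
  choose Xn hXn πn hπn Dn hbl hcl hP using H
  let S : Type 1 := Σ' (X₁ : Scheme.{0}) (_ : IsIntegral X₁) (Φ : X₁ ⟶ X) (_ : IsDominant Φ) (J₁ : X₁.IdealSheafData),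
    IsCleanPermissibleSeq p Φ J μ J₁ G
  let next : S → S := fun s =>
    ⟨@Xn s.1 s.2.1 s.2.2.1 s.2.2.2.1 s.2.2.2.2.1 s.2.2.2.2.2, @hXn s.1 s.2.1 s.2.2.1 s.2.2.2.1 s.2.2.2.2.1 s.2.2.2.2.2,
      @πn s.1 s.2.1 s.2.2.1 s.2.2.2.1 s.2.2.2.2.1 s.2.2.2.2.2 ≫ s.2.2.1,
      ⟨(@Scheme.Hom.denseRange _ _ s.2.2.1 s.2.2.2.1).comp
        (@Scheme.Hom.denseRange _ _ (@πn s.1 s.2.1 s.2.2.1 s.2.2.2.1 s.2.2.2.2.1 s.2.2.2.2.2)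
          (@hπn s.1 s.2.1 s.2.2.1 s.2.2.2.1 s.2.2.2.2.1 s.2.2.2.2.2)) s.2.2.1.continuous⟩,
      controlledTransform (@πn s.1 s.2.1 s.2.2.1 s.2.2.2.1 s.2.2.2.2.1 s.2.2.2.2.2)
        (vanishingIdeal (@Dn s.1 s.2.1 s.2.2.1 s.2.2.2.1 s.2.2.2.2.1 s.2.2.2.2.2)) s.2.2.2.2.1 μ,
      @hcl s.1 s.2.1 s.2.2.1 s.2.2.2.1 s.2.2.2.2.1 s.2.2.2.2.2⟩
  let s₀ : S := ⟨X, inferInstance, 𝟙 X, inferInstance, J, IsCleanPermissibleSeq.nil J μ G⟩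
  let ch : ℕ → S := fun n => Nat.rec s₀ (fun _ s => next s) n
  refine ⟨fun n => (ch n).1, fun n => (ch n).2.1,
    fun n => @πn (ch n).1 (ch n).2.1 (ch n).2.2.1 (ch n).2.2.2.1 (ch n).2.2.2.2.1 (ch n).2.2.2.2.2,
    fun n => @Dn (ch n).1 (ch n).2.1 (ch n).2.2.1 (ch n).2.2.2.1 (ch n).2.2.2.2.1 (ch n).2.2.2.2.2,
    fun n => (ch n).2.2.2.2.1, fun n => (ch n).2.2.1, fun n => (ch n).2.2.2.1,
    fun n => @hbl (ch n).1 (ch n).2.1 (ch n).2.2.1 (ch n).2.2.2.1 (ch n).2.2.2.2.1 (ch n).2.2.2.2.2, fun n => (ch n).2.2.2.2.2,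
    fun n => rfl, fun n => @hP (ch n).1 (ch n).2.1 (ch n).2.2.1 (ch n).2.2.2.1 (ch n).2.2.2.2.1 (ch n).2.2.2.2.2⟩

/-! ## §2 Clean Phase I -/

set_option maxHeartbeats 800000 in
-- the long binder lists of the curve-configuration termination theorem
/-- **CLEAN PHASE I of reach-tidy (steps 1–2 of [CoP1] Prop. 4.4 terminate, with clean centres).**  See the module docstring.  Clean twin of
✓ `CP2008Prop44.exists_seq_regular_transverse`. [cite: CossartPiltant2008, Prop. 4.4 (proof, p. 10, steps 1–2)] [cite: Piltant2013, §2 Axiom 2 (ii)] -/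
theorem exists_cleanSeq_regular_transverse {p : ℕ} (hp : p.Prime) {X : Scheme.{0}} [IsIntegral X] [IsNoetherian X]
    [CharP X.functionField p] (hX : Scheme.IsRegular X) (hqe : Scheme.IsQuasiExcellent X) (hX3 : topologicalKrullDim X ≤ 3)
    (G : X.functionField) (hG : ∀ x : X, CleanRegAt p (algebraMap (X.presheaf.stalk x) X.functionField) G)
    (J : X.IdealSheafData) {μ : ℕ} (hμ : 1 ≤ μ) (hle : ∀ z, idealOrder J z ≤ μ) (hcodim : ∀ z ∈ J.support, 1 < Order.coheight z) :
    ∃ (X₁ : Scheme.{0}) (Φ : X₁ ⟶ X) (_ : IsIntegral X₁) (_ : IsDominant Φ) (J₁ : X₁.IdealSheafData)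
      (_ : IsCleanPermissibleSeq p Φ J μ J₁ G),
      ∀ x : X₁, ¬ ∃ C ∈ {C : Closeds X₁ | ∃ ζ ∈ maxPoints {z : X₁ | (μ : ℕ∞) ≤ idealOrder J₁ z},
          ¬ IsClosed ({ζ} : Set X₁) ∧ C = ⟨closure {ζ}, isClosed_closure⟩},
        x ∈ (vanishingIdeal C).subschemeι '' (Scheme.regularLocus (vanishingIdeal C).subscheme)ᶜ ∨
        (x ∈ (C : Set X₁) ∧ ∃ C' ∈ {C : Closeds X₁ | ∃ ζ ∈ maxPoints {z : X₁ | (μ : ℕ∞) ≤ idealOrder J₁ z},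
            ¬ IsClosed ({ζ} : Set X₁) ∧ C = ⟨closure {ζ}, isClosed_closure⟩}, C' ≠ C ∧ x ∈ (C' : Set X₁) ∧
          stalkIdeal (vanishingIdeal C) x ⊔ stalkIdeal (vanishingIdeal C') x ≠ maximalIdeal (X₁.presheaf.stalk x)) := by
  classical
  by_contra Hc
  -- the invariants at every reachable stage (over the forgetful map to the W4.6 currency)
  have inv := fun {X₁ : Scheme.{0}} [IsIntegral X₁] {Φ : X₁ ⟶ X} [IsDominant Φ] {J₁ : X₁.IdealSheafData}
      (h : IsCleanPermissibleSeq p Φ J μ J₁ G) =>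
    IsPermissibleBlowupSeq.prop44Invariants hX hqe hμ hle hcodim (isPermissibleBlowupSeq_of_isPermissibleSeq h.isPermissibleSeq)
  -- the property recorded at each step: the centre is a bad point
  let P : ∀ (X₁ : Scheme.{0}), X₁.IdealSheafData → Closeds X₁ → Prop := fun X₁ J₁ D =>
    ∃ (x : X₁) (hx : IsClosed ({x} : Set X₁)), D = ⟨{x}, hx⟩ ∧ idealOrder J₁ x = μ ∧
      (maximalIdeal (X₁.presheaf.stalk x)).spanFinrank = 3 ∧
      ∃ C ∈ {C : Closeds X₁ | ∃ ζ ∈ maxPoints {z : X₁ | (μ : ℕ∞) ≤ idealOrder J₁ z},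
          ¬ IsClosed ({ζ} : Set X₁) ∧ C = ⟨closure {ζ}, isClosed_closure⟩},
        x ∈ (vanishingIdeal C).subschemeι '' (Scheme.regularLocus (vanishingIdeal C).subscheme)ᶜ ∨
        (x ∈ (C : Set X₁) ∧ ∃ C' ∈ {C : Closeds X₁ | ∃ ζ ∈ maxPoints {z : X₁ | (μ : ℕ∞) ≤ idealOrder J₁ z},
            ¬ IsClosed ({ζ} : Set X₁) ∧ C = ⟨closure {ζ}, isClosed_closure⟩}, C' ≠ C ∧ x ∈ (C' : Set X₁) ∧
          stalkIdeal (vanishingIdeal C) x ⊔ stalkIdeal (vanishingIdeal C') x ≠ maximalIdeal (X₁.presheaf.stalk x))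
  have H : ∀ (X₁ : Scheme.{0}) [IsIntegral X₁] (Φ : X₁ ⟶ X) [IsDominant Φ] (J₁ : X₁.IdealSheafData),
      IsCleanPermissibleSeq p Φ J μ J₁ G →
      ∃ (X₂ : Scheme.{0}) (_ : IsIntegral X₂) (π : X₂ ⟶ X₁) (_ : IsDominant π) (D : Closeds X₁),
        IsBlowup π (vanishingIdeal D) ∧ IsCleanPermissibleSeq p (π ≫ Φ) J μ (controlledTransform π (vanishingIdeal D) J₁ μ) G ∧
        P X₁ J₁ D := by
    intro X₁ _ Φ _ J₁ hseq
    obtain ⟨-, hnoeth₁, hX₁, hqe₁, hle₁, hcodim₁⟩ := inv hseq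
    haveI := hnoeth₁
    have hX3₁ : topologicalKrullDim X₁ ≤ 3 :=
      (isPermissibleBlowupSeq_of_isPermissibleSeq hseq.isPermissibleSeq).topologicalKrullDim_le inferInstance hX3
    -- a bad point exists at this stage
    have hbad : ∃ x : X₁, ∃ C ∈ {C : Closeds X₁ | ∃ ζ ∈ maxPoints {z : X₁ | (μ : ℕ∞) ≤ idealOrder J₁ z},
          ¬ IsClosed ({ζ} : Set X₁) ∧ C = ⟨closure {ζ}, isClosed_closure⟩},
        x ∈ (vanishingIdeal C).subschemeι '' (Scheme.regularLocus (vanishingIdeal C).subscheme)ᶜ ∨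
        (x ∈ (C : Set X₁) ∧ ∃ C' ∈ {C : Closeds X₁ | ∃ ζ ∈ maxPoints {z : X₁ | (μ : ℕ∞) ≤ idealOrder J₁ z},
            ¬ IsClosed ({ζ} : Set X₁) ∧ C = ⟨closure {ζ}, isClosed_closure⟩}, C' ≠ C ∧ x ∈ (C' : Set X₁) ∧
          stalkIdeal (vanishingIdeal C) x ⊔ stalkIdeal (vanishingIdeal C') x ≠ maximalIdeal (X₁.presheaf.stalk x)) := by
      by_contra h
      exact Hc ⟨X₁, Φ, inferInstance, inferInstance, J₁, hseq, fun x hx => h ⟨x, hx⟩⟩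
    obtain ⟨x, C, hC, hxbad⟩ := hbad
    obtain ⟨hxcl, hordx, hdimx⟩ := isClosed_of_bad hX₁ hX3₁ J₁ hμ hle₁ hcodim₁ (𝒞 := {C : Closeds X₁ | _})
      (fun C => Iff.rfl) hC hxbad
    -- the centre is a nonzero ideal (the embedding dimension is `3`)
    haveI : IsRegularLocalRing (X₁.presheaf.stalk x) := hX₁ x
    have hDbot : vanishingIdeal (⟨{x}, hxcl⟩ : Closeds X₁) ≠ ⊥ := by
      intro hbot
      have h1 : maximalIdeal (X₁.presheaf.stalk x) = ⊥ := by
        rw [← stalkIdeal_vanishingIdeal_singleton hxcl, hbot, stalkIdeal_bot]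
      have h2 := hdimx
      rw [h1, Submodule.spanFinrank_bot] at h2
      exact absurd h2 (by norm_num)
    obtain ⟨X₂, π, hπ⟩ := exists_isBlowup X₁ (vanishingIdeal (⟨{x}, hxcl⟩ : Closeds X₁))
    haveI : IsIntegral X₂ := hπ.isIntegral hDbot
    haveI : IsDominant π := isDominant_of_isBlowup_of_ne_bot hπ hDbot
    have hstep : IsCleanPermissibleSeq p (π ≫ Φ) J μ (controlledTransform π (vanishingIdeal (⟨{x}, hxcl⟩ : Closeds X₁)) J₁ μ) G :=
      IsCleanPermissibleSeq.cons_point hp π Φ J μ J₁ G hseq x hxcl (isIntegral_subscheme_vanishingIdeal_singleton hxcl)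
        (CampaignW46.isRegular_subscheme_vanishingIdeal_singleton hxcl) hordx hπ (hseq.cleanRegAt hp inferInstance hG x)
    exact ⟨X₂, inferInstance, π, inferInstance, ⟨{x}, hxcl⟩, hπ, hstep, x, hxcl, rfl, hordx, hdimx, C, hC, hxbad⟩
  obtain ⟨Xs, hXs, π, D, Js, Φ, hΦ, hπ, hseq, hJ, hP⟩ := exists_cleanChain_of_forall_step J G P H
  -- read off the bad points
  choose x hx hDx hordx hdimx hbadx using hP
  have hπ' : ∀ n, IsBlowup (π n) (vanishingIdeal ⟨{x n}, hx n⟩) := fun n => hDx n ▸ hπ n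
  have hJ' : ∀ n, Js (n + 1) = controlledTransform (π n) (vanishingIdeal ⟨{x n}, hx n⟩) (Js n) μ := fun n => hDx n ▸ hJ n
  -- stage invariants
  have hnoeth : ∀ n, IsNoetherian (Xs n) := fun n => by
    haveI := hXs n; haveI := hΦ n; exact (inv (hseq n)).2.1
  haveI : ∀ n, IsLocallyNoetherian (Xs n) := fun n => by haveI := hnoeth n; infer_instance
  have hreg : ∀ n, Scheme.IsRegular (Xs n) := fun n => by
    haveI := hXs n; haveI := hΦ n; exact (inv (hseq n)).2.2.1
  have hqe' : ∀ n, Scheme.IsQuasiExcellent (Xs n) := fun n => by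
    haveI := hXs n; haveI := hΦ n; exact (inv (hseq n)).2.2.2.1
  have hle' : ∀ n, ∀ z, idealOrder (Js n) z ≤ μ := fun n => by
    haveI := hXs n; haveI := hΦ n; exact (inv (hseq n)).2.2.2.2.1
  have hcodim' : ∀ n, ∀ z ∈ (Js n).support, 1 < Order.coheight z := fun n => by
    haveI := hXs n; haveI := hΦ n; exact (inv (hseq n)).2.2.2.2.2
  have hX3' : ∀ n, topologicalKrullDim (Xs n) ≤ 3 := fun n => by
    haveI := hXs n; haveI := hΦ n; haveI := hnoeth n
    exact (isPermissibleBlowupSeq_of_isPermissibleSeq (hseq n).isPermissibleSeq).topologicalKrullDim_le inferInstance hX3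
  have hcoh3 : ∀ n, ∀ z : Xs n, Order.coheight z ≤ 3 := fun n =>
    (topologicalKrullDim_le_iff_forall_coheight_le (Xs n) 3).mp (hX3' n)
  -- the configurations of curves
  let 𝒞 : ∀ n, Set (Closeds (Xs n)) := fun n => {C : Closeds (Xs n) | ∃ ζ ∈ maxPoints {z : Xs n | (μ : ℕ∞) ≤ idealOrder (Js n) z},
    ¬ IsClosed ({ζ} : Set (Xs n)) ∧ C = ⟨closure {ζ}, isClosed_closure⟩}
  have hmaxord : ∀ n, ∀ ζ ∈ maxPoints {z : Xs n | (μ : ℕ∞) ≤ idealOrder (Js n) z}, (μ : ℕ∞) ≤ idealOrder (Js n) ζ :=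
    fun n ζ hζ => by simpa only [Set.mem_setOf_eq] using maxPoints_subset _ hζ
  have hsupp : ∀ n, ∀ ζ ∈ maxPoints {z : Xs n | (μ : ℕ∞) ≤ idealOrder (Js n) z}, ζ ∈ (Js n).support := fun n ζ hζ => by
    rw [← one_le_idealOrder_iff]
    exact le_trans (show (1 : ℕ∞) ≤ (μ : ℕ∞) by exact_mod_cast hμ) (hmaxord n ζ hζ)
  refine false_of_badPointChain_of_curveConfiguration Xs π x hx hπ' 𝒞 (fun n => ?_) (fun n C hC => ?_) (fun n C hC => ?_)
    (fun n C hC => ?_) (fun n C hC => ?_) (fun n C hC C₂ hC₂ hsub => ?_) (fun n => hbadx n)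
    (fun n C₁ hC₁ => ?_)
  · -- finitely many curves
    have hJne : Js n ≠ ⊥ := ne_bot_of_forall_one_lt_coheight (hcodim' n)
    have hcl : IsClosed {z : Xs n | (μ : ℕ∞) ≤ idealOrder (Js n) z} :=
      isClosed_setOf_le_idealOrder_of_isJ2 (hreg n) (fun U => ((hqe' n) U).isJ2Ring) hJne μ
    refine ((maxPoints_finite hcl).image fun ζ => (⟨closure {ζ}, isClosed_closure⟩ : Closeds (Xs n))).subset ?_
    rintro C ⟨ζ, hζ, -, rfl⟩
    exact ⟨ζ, hζ, rfl⟩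
  · obtain ⟨ζ, -, -, rfl⟩ := hC
    exact isIntegral_subscheme_closure ζ
  · obtain ⟨ζ, -, -, rfl⟩ := hC
    haveI := hnoeth n
    exact isNoetherian_subscheme_closure ζ
  · obtain ⟨ζ, -, -, rfl⟩ := hC
    exact isQuasiExcellent_subscheme_closure (hqe' n) ζ
  · obtain ⟨ζ, hζ, hζcl, rfl⟩ := hC
    exact topologicalKrullDim_subscheme_closure_eq_one (hX3' n)
      (coheight_eq_two_of_not_isClosed (hcoh3 n) (hcodim' n _ (hsupp n ζ hζ)) hζcl) hζcl
  · -- pairwise incomparable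
    obtain ⟨ζ, hζ, -, rfl⟩ := hC
    obtain ⟨ζ₂, hζ₂, -, rfl⟩ := hC₂
    have hmem : ζ ∈ closure ({ζ₂} : Set (Xs n)) := hsub (subset_closure (Set.mem_singleton ζ))
    have heq : ζ₂ = ζ := (mem_maxPoints_iff.mp hζ).2 ζ₂ (hmaxord n ζ₂ hζ₂) (specializes_iff_mem_closure.mpr hmem)
    rw [heq]
  · -- the successor rule
    exact pointStep_next (hreg n) (hX3' n) (Js n) hμ (hle' n) (hcodim' n) (hx n) (hordx n) (hdimx n) (hπ' n)
      (𝒞 := 𝒞 n) (fun C => Iff.rfl) (𝒞' := 𝒞 (n + 1)) (fun C' => by rw [← hJ' n]; rfl) C₁ hC₁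

end Summit.ResolutionOfSingularities.ResolutionOfSingularities.Theorems.RadicialJung.CleanModels

end
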